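import Summits.KontsevichZagierPeriods.KontsevichZagierPeriods.Theorems.SymplecticScissorsPlanarCompilerStubElementaryMovesAux

/-!
# One-dimensional Sard and null vertical cylinders

Helper of the (unconditional) algebraic-area layer of crux `stmt-KontsevichZagierPeriods-9847`
(`PlanarK0Injective`, route SymplecticScissors, line lead seat c5).

When a band of a cylindrical decomposition is flattened by `(x, y) ↦ (F x, …)`, the part of the
target strip that is not covered lies over `F` of the bad abscissae: finitely many singular ones and
the set `Z` where `F' = 0`. The two lemmas of this file make that uncovered part Lebesgue-null:

* `volume_image_eq_zero_of_hasDerivAt_zero`: Sard's lemma in dimension one — the image under `F` of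
  a set on which `F` has derivative `0` is null (a special case of Mathlib's
  `MeasureTheory.addHaar_image_eq_zero_of_det_fderivWithin_eq_zero`);
* `volume_setOf_apply_zero_mem_eq_zero`: the vertical cylinder `{q | q 0 ∈ A}` over a null set of
  abscissae `A ⊆ ℝ` is a null subset of the plane `Fin 2 → ℝ`.
-/

noncomputable section

open MeasureTheory Set

namespace Summit.KontsevichZagierPeriods.SymplecticScissors.PlanarK0InjectiveAlgebraicLayer

/-- **Sard's lemma in dimension one.** If `F : ℝ → ℝ` has derivative `0` at every point of `Z`,
then the image `F '' Z` is Lebesgue-null. This is the special case `f' ≡ 0` (whose determinant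
vanishes) of Mathlib's `MeasureTheory.addHaar_image_eq_zero_of_det_fderivWithin_eq_zero`; no
measurability of `Z` is needed. [folklore] -/
theorem volume_image_eq_zero_of_hasDerivAt_zero {F : ℝ → ℝ} {Z : Set ℝ}
    (hZ : ∀ t ∈ Z, HasDerivAt F 0 t) : volume (F '' Z) = 0 := by
  have hdet : (ContinuousLinearMap.smulRight (1 : ℝ →L[ℝ] ℝ) (0 : ℝ)).det = 0 := by
    have h0 : ContinuousLinearMap.smulRight (1 : ℝ →L[ℝ] ℝ) (0 : ℝ) = 0 := by
      ext
      simp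
    rw [h0]
    simp [ContinuousLinearMap.det]
  exact addHaar_image_eq_zero_of_det_fderivWithin_eq_zero volume
    (f' := fun _ => ContinuousLinearMap.smulRight (1 : ℝ →L[ℝ] ℝ) (0 : ℝ))
    (fun t ht => (hasDerivAt_iff_hasFDerivAt.1 (hZ t ht)).hasFDerivWithinAt) (fun _ _ => hdet)

/-- **A vertical cylinder over a null set of abscissae is null.** If `A ⊆ ℝ` is Lebesgue-null, then
so is the planar set `{q : Fin 2 → ℝ | q 0 ∈ A}`, i.e. the preimage of `A` under the first
coordinate projection; this is `MeasureTheory.Measure.pi_eval_preimage_null` for the product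
Lebesgue measure on `Fin 2 → ℝ` (no measurability of `A` is needed). [folklore] -/
theorem volume_setOf_apply_zero_mem_eq_zero {A : Set ℝ} (hA : volume A = 0) :
    volume {q : Fin 2 → ℝ | q 0 ∈ A} = 0 :=
  Measure.pi_eval_preimage_null (fun _ : Fin 2 => (volume : Measure ℝ)) (i := 0) hA

/-- **Registered form of this file's two lemmas** (stub `helper_algebraicLayer_sard` of crux
`stmt-KontsevichZagierPeriods-9847`): one-dimensional Sard for a function with derivative `0` on a
set, and nullity of the vertical cylinder over a null set of abscissae; it is the conjunction of
`volume_image_eq_zero_of_hasDerivAt_zero` and `volume_setOf_apply_zero_mem_eq_zero`. [folklore] -/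
theorem helper_algebraicLayer_sard :
    (∀ (F : ℝ → ℝ) (Z : Set ℝ), (∀ t ∈ Z, HasDerivAt F 0 t) → MeasureTheory.volume (F '' Z) = 0) ∧
      (∀ (A : Set ℝ), MeasureTheory.volume A = 0 →
        MeasureTheory.volume {q : Fin 2 → ℝ | q 0 ∈ A} = 0) :=
  ⟨fun _ _ hZ => volume_image_eq_zero_of_hasDerivAt_zero hZ,
    fun _ hA => volume_setOf_apply_zero_mem_eq_zero hA⟩

end Summit.KontsevichZagierPeriods.SymplecticScissors.PlanarK0InjectiveAlgebraicLayer
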